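import Summits.ResolutionOfSingularities.ResolutionOfSingularities.Theorems.RadicialJungCleanModelsLens5TFrameTwoField3
import Summits.ResolutionOfSingularities.ResolutionOfSingularities.Theorems.RadicialJungCleanModelsMonomializationOfThm11
import HarnessLib

/-!
# RadicialJungCleanModelsLens5TFrameTwoField3 — re-threaded through Cossart–Piltant 2019 Thm. 1.1 (i)–(iii) (`_thm11` variants)

Route `RadicialJung`, crux `CleanModels` (stmt-ResolutionOfSingularities-15917), line `Sketch`.  The declarations below are the
tree's theorems of the same names WITHOUT the suffix `_thm11` (file `RadicialJungCleanModelsLens5TFrameTwoField3.lean`), with the embedded-resolution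
HYPOTHESIS `hEmb` (CJS 2020 Cor. 1.5 shape; skeleton stub `stub_cjs2020Thm14` = F-32) REPLACED by the typed verbatim
Cossart–Piltant 2019 Thm. 1.1 (i)–(iii) `CP2019.CossartPiltant2019Thm11`, through the doubling trick
(`Doubling.hEmb_zeroLocus_of_thm11`, `exists_localRing_monomial_of_thm11_dim`).  Proof bodies are the tree's, verbatim — credit to
the original file and its authors (res-B-lens-5, res-B-lead-1 and workers); only the binder and the threaded call differ.  
OURS; nothing here proves resolution in characteristic `p`.
-/

set_option linter.dupNamespace false -- mandated namespace of this single-conjunct summit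

noncomputable section

section

open IsLocalRing
open Literature.AlgebraicGeometry.Resolution
open Summit.ResolutionOfSingularities.ResolutionOfSingularities.Theorems.RadicialJung.CleanModels
open Summit.ResolutionOfSingularities.ResolutionOfSingularities.Theorems.RadicialJung.CleanModels.Lens5
open Summit.ResolutionOfSingularities.ResolutionOfSingularities.Theorems.RadicialJung.CleanModels.Lens5.PRankTwoCurrency
open Summit.ResolutionOfSingularities.ResolutionOfSingularities.Theorems.RadicialJung.CleanModels.Lens5.PRankTwoAssembly
open Summit.ResolutionOfSingularities.ResolutionOfSingularities.Theorems.RadicialJungCleanModels.Lens5RegularityCriterion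
open Summit.ResolutionOfSingularities.ResolutionOfSingularities.Theorems.RadicialJungCleanModels.Lens5ChartSurjection

namespace Summit.ResolutionOfSingularities.ResolutionOfSingularities.Theorems.RadicialJungCleanModels.Lens5TFrame

namespace TwoField

variable {k₀ : Type} [Field k₀] {k : Type} [Field k] {K : Type} [Field K]
  [Algebra k₀ k] [Algebra k₀ K] [Algebra k K] [IsScalarTower k₀ k K]

/-! ## PORT 2′_∞ core — the monomialising regular `k₀`-model inside `M` (F-02 over the small field `k₀`, F-32 verbatim), `A` a `k`-model -/

open AlgebraicGeometry CategoryTheory in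
set_option maxHeartbeats 800000 in
/-- **PORT 2 core, two-field version.**  Copy of `Lens5_TPrime.lean` rev 3 `port_monomialModel_core` (itself ✓ `PRankTwoAssembly.port_monomialModel`
without `PerfectField`) in which the affine model `A = k[t]` stays a `k`-algebra while F-02 (`hLU : LocalUniformization3 k₀`) and the whole
M-side (twist field `k₀(t^p ∪ {g₁}) = K^p(g₀^{±1}) = M`, regular model `A'`, re-model `A₂ = k₀[A' ∪ uu]`) live over a SMALL field `k₀ → k`
with `k₀ ⊆ K^p` (`hk₀p`) and `k^p ⊆ k₀` (`hFrob`) — so that `A` need NOT be finitely generated over `k₀` (the point of T′_∞: `[k : k^p] = ∞`).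
Consumes F-02 (`hLU`, via `exists_twist_model₂`) and F-32 (`hEmb`, via ✓ `exists_localRing_monomial_of_embeddedResolution`).
[cite: CossartPiltant2019, Thm. 1.1; CossartJannsenSaito2020, Thm. 1.6.3 (F-32)] -/
theorem port_monomialModel_core₂_thm11 (p : ℕ) [Fact p.Prime] [CharP K p]
    (hFrob : ∀ c : k, ∃ c₀ : k₀, algebraMap k₀ K c₀ = algebraMap k K c ^ p)
    (hk₀p : ∀ c₀ : k₀, ∃ d : K, algebraMap k₀ K c₀ = d ^ p)
    (hLU : LocalUniformization3 k₀)
    (h11 : Literature.AlgebraicGeometry.CossartPiltant200819.CP2019.CossartPiltant2019Thm11.{0})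
    (O : ValuationSubring K) (A : Subalgebra k K)
    (hAO : A.toSubring ≤ O.toSubring) (hAfg : A.FG) [IsFractionRing A K] (hdimA : ringKrullDim A ≤ 3)
    (hdim3 : ringKrullDim (locAtCentre A.toSubring O) = 3)
    (hzd : ∀ (T : Subring K) (hT : T ≤ O.toSubring), A.toSubring ≤ T → (subringCentre T O hT).IsMaximal)
    (t : Finset K) (ht : Algebra.adjoin k (t : Set K) = A)
    (g₀ : K) (M : Subfield K) (hM : ∀ x : K, x ∈ M ↔ ∃ c : Fin p → K, ∑ j, c j ^ p * g₀ ^ (j : ℕ) = x)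
    (F : Finset K) (hFM : ∀ f ∈ F, f ∈ M) (hF0 : ∀ f ∈ F, f ≠ 0) :
    ∃ (A₂ : Subalgebra k₀ K) (_ : A₂.toSubring ≤ O.toSubring), A₂.FG ∧ (∀ a ∈ A, a ^ p ∈ A₂) ∧
      (∀ r : K, r ∈ locAtCentre A₂.toSubring O → r ∈ M) ∧
      ∃ (_ : IsRegularLocalRing (locAtCentre A₂.toSubring O)) (z : Fin 3 → locAtCentre A₂.toSubring O),
        Ideal.span (Set.range z) = IsLocalRing.maximalIdeal (locAtCentre A₂.toSubring O) ∧
        ringKrullDim (locAtCentre A₂.toSubring O) = 3 ∧ (∀ i, ((z i : K)) ≠ 0) ∧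
        ∀ f ∈ F, ∃ (ε : K) (e : Fin 3 → ℤ), ε ∈ locAtCentre A₂.toSubring O ∧ O.valuation ε = 1 ∧
          f = ε * ∏ i, ((z i : K)) ^ (e i) := by
  classical
  have hp : p.Prime := Fact.out
  have hdimAeq : ringKrullDim A = 3 := ringKrullDim_eq_three_of_locAtCentre O A hAO hdimA hdim3
  have hk : ∀ c : k, algebraMap k K c ∈ O := fun c => hAO (A.algebraMap_mem c)
  have hk₀O : ∀ c : k₀, algebraMap k₀ K c ∈ O := fun c => by
    rw [IsScalarTower.algebraMap_apply k₀ k K]; exact hk _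
  -- the `k₀`-subalgebra `O` (for `Algebra.adjoin_le` arguments)
  let Ok : Subalgebra k₀ K := { O.toSubring with algebraMap_mem' := hk₀O }
  have hOk : ∀ x : K, x ∈ Ok ↔ x ∈ O := fun _ => Iff.rfl
  obtain ⟨g₁, hg₁O, hg₁⟩ := TwistModel.mem_or_inv_mem_valuationSubring O g₀
  -- ## the twist field `k₀(S)`, `S = t^p ∪ {g₁}`, and its regular model (F-02 at `k₀`, `exists_twist_model₂`)
  set S : Set K := (fun x : K => x ^ p) '' (t : Set K) ∪ {g₁} with hSdef
  obtain ⟨A', hA'O', hSA', hA'fg, hreg', hexc, hdim', hRO, hRm⟩ :=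
    exists_twist_model₂ p hFrob hLU O A hAO hAfg hdimAeq t ht hzd g₁ hg₁O S hSdef
  set R : Subring (IntermediateField.adjoin k₀ S) :=
    locAtCentre A'.toSubring (O.comap (algebraMap (IntermediateField.adjoin k₀ S) K)) with hRdef
  haveI : IsRegularLocalRing R := hreg'
  haveI : IsScalarTower R (IntermediateField.adjoin k₀ S) K := IsScalarTower.of_algebraMap_eq (fun _ => rfl)
  have halgR : ∀ r : R, algebraMap R K r = ((r : IntermediateField.adjoin k₀ S) : K) := fun _ => rfl
  -- ## `k₀(S)` has underlying subfield `M = K^p(g₀)` (`adjoin_twist_toSubfield_eq₂`)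
  have hM'sub : (IntermediateField.adjoin k₀ S).toSubfield = Subfield.closure (Set.range (frobenius K p) ∪ {g₀}) := by
    rw [hSdef, adjoin_twist_toSubfield_eq₂ p hFrob hk₀p A (t : Set K) ht g₁]
    rcases hg₁ with h | h
    · rw [h]
    · rw [h, TwistModel.subfield_closure_union_inv_eq]
  have hM'M : ∀ x : K, x ∈ IntermediateField.adjoin k₀ S ↔ x ∈ M := by
    intro x
    rw [← IntermediateField.mem_toSubfield, hM'sub]
    constructor
    · intro hx
      refine (Subfield.closure_le (t := M)).mpr ?_ hx
      rintro y (⟨c, rfl⟩ | hy)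
      · refine (hM _).mpr ⟨fun j => if (j : ℕ) = 0 then c else 0, ?_⟩
        rw [Finset.sum_eq_single (⟨0, hp.pos⟩ : Fin p)]
        · simp [frobenius_def]
        · intro j _ hj
          have hj' : (j : ℕ) ≠ 0 := fun h => hj (Fin.ext h)
          simp [hj', hp.ne_zero]
        · intro h; exact absurd (Finset.mem_univ _) h
      · rw [Set.mem_singleton_iff.mp hy]
        refine (hM _).mpr ⟨fun j => if (j : ℕ) = 1 then 1 else 0, ?_⟩
        rw [Finset.sum_eq_single (⟨1, hp.one_lt⟩ : Fin p)]
        · simp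
        · intro j _ hj
          have hj' : (j : ℕ) ≠ 1 := fun h => hj (Fin.ext h)
          simp [hj', hp.ne_zero]
        · intro h; exact absurd (Finset.mem_univ _) h
    · intro hx
      obtain ⟨c, rfl⟩ := (hM x).mp hx
      have hg₀c : g₀ ∈ Subfield.closure (Set.range (frobenius K p) ∪ {g₀}) := Subfield.subset_closure (Or.inr rfl)
      refine sum_mem fun j _ => mul_mem ?_ (pow_mem hg₀c _)
      exact Subfield.subset_closure (Or.inl ⟨c j, frobenius_def _ _⟩)
  -- ## every `f ∈ F` is a quotient of two non-zero elements of `k₀[S]`, which lift to `R`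
  have hFfrac : ∀ f ∈ F, ∃ c d : K, c ∈ Algebra.adjoin k₀ S ∧ d ∈ Algebra.adjoin k₀ S ∧ c ≠ 0 ∧ d ≠ 0 ∧ f = c / d := by
    intro f hf
    have hfM' : f ∈ IntermediateField.adjoin k₀ S := (hM'M f).mpr (hFM f hf)
    obtain ⟨c, hc, d, hd, hcd⟩ := IntermediateField.mem_adjoin_iff_div.mp hfM'
    have hd0 : d ≠ 0 := by
      rintro rfl
      rw [div_zero] at hcd
      exact hF0 f hf hcd
    have hc0 : c ≠ 0 := by
      rintro rfl
      rw [zero_div] at hcd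
      exact hF0 f hf hcd
    exact ⟨c, d, hc, hd, hc0, hd0, hcd⟩
  choose! cF dF hcF hdF hcF0 hdF0 hFeq using hFfrac
  have hpre : ∀ c : K, c ∈ Algebra.adjoin k₀ S → ∃ r : R, algebraMap R K r = c := by
    intro c hc
    have hcM' : c ∈ IntermediateField.adjoin k₀ S := IntermediateField.algebra_adjoin_le_adjoin k₀ S hc
    have h1 : (⟨c, hcM'⟩ : IntermediateField.adjoin k₀ S) ∈ A' :=
      hSA' ((TwistModel.mem_adjoin_preimage_iff S ⟨c, hcM'⟩).mpr hc)
    exact ⟨⟨⟨c, hcM'⟩, le_locAtCentre A'.toSubring _ h1⟩, rfl⟩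
  have hcpre : ∀ f ∈ F, ∃ r : R, algebraMap R K r = cF f := fun f hf => hpre _ (hcF f hf)
  have hdpre : ∀ f ∈ F, ∃ r : R, algebraMap R K r = dF f := fun f hf => hpre _ (hdF f hf)
  choose! rc hrc using hcpre
  choose! rd hrd using hdpre
  -- ## the element to monomialise: `xR = g · ∏_f c_f d_f`, `0 ≠ g ∈ 𝔪_R`
  have hmne : maximalIdeal R ≠ ⊥ := by
    intro h
    have hf : IsField R := (IsLocalRing.isField_iff_maximalIdeal_eq).mpr h
    have h0 := ringKrullDim_eq_zero_of_isField hf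
    rw [hdim'] at h0
    norm_num at h0
  obtain ⟨g, hgm, hg0⟩ := Submodule.exists_mem_ne_zero_of_ne_bot hmne
  set xR : R := g * ∏ f ∈ F, (rc f * rd f) with hxRdef
  have hxR0 : xR ≠ 0 := by
    refine mul_ne_zero hg0 (Finset.prod_ne_zero_iff.mpr fun f hf => mul_ne_zero ?_ ?_)
    · intro h
      exact hcF0 f hf (by rw [← hrc f hf, h, map_zero])
    · intro h
      exact hdF0 f hf (by rw [← hrd f hf, h, map_zero])
  have hxRm : xR ∈ maximalIdeal R := Ideal.mul_mem_right _ _ hgm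
  -- ## F-32 on the M-side model
  have hRO' : ∀ r : R, algebraMap R K r ∈ O := fun r => hRO r
  have hRm' : ∀ r : R, r ∈ maximalIdeal R ↔ O.valuation (algebraMap R K r) < 1 := fun r => hRm r
  obtain ⟨uu, huuM', huuO, R', _, _, _, hinj, hR'O, hR'm, hlow, hup, d, z, α, u, hu, hdimR', hspan, hfact⟩ :=
    exists_localRing_monomial_of_thm11_dim (n := 2) le_rfl h11 (R := R) (K := IntermediateField.adjoin k₀ S) (E := K)
      Subtype.val_injective hexc (by rw [hdim']; rfl) O
      hRO' hRm' xR hxR0 hxRm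
  -- ## RE-MODEL on the `K`-side: `T = R[uu]`, `B = A'` read in `K`, `A₂ = k₀[B ∪ uu]`, `locAtCentre T O = locAtCentre A₂ O`
  let T : Subring K := (Algebra.adjoin R (uu : Set K)).toSubring
  have hTO : T ≤ O.toSubring := fun w hw => huuO w hw
  have hTR : ∀ w ∈ T, w ∈ Set.range (algebraMap R' K) := fun w hw => hlow w hw
  have hRT : ∀ r : R, algebraMap R K r ∈ T := fun r => (Algebra.adjoin R (uu : Set K)).algebraMap_mem r
  have huuO' : ∀ w ∈ (uu : Set K), w ∈ O := fun w hw => huuO w (Algebra.subset_adjoin hw)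
  set φ : IntermediateField.adjoin k₀ S →ₐ[k₀] K := IsScalarTower.toAlgHom k₀ (IntermediateField.adjoin k₀ S) K with hφdef
  have hφ : ∀ y : IntermediateField.adjoin k₀ S, φ y = (y : K) := fun _ => rfl
  set B : Subalgebra k₀ K := A'.map φ with hBdef
  have hBfg : B.FG := hA'fg.map φ
  have hBO : ∀ x ∈ (B : Set K), x ∈ O := by
    intro x hx
    obtain ⟨y, hy, rfl⟩ := Subalgebra.mem_map.mp hx
    exact ValuationSubring.mem_comap.mp (hA'O' hy)
  set A₂ : Subalgebra k₀ K := Algebra.adjoin k₀ ((B : Set K) ∪ ↑uu) with hA₂def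
  have hA₂fg : A₂.FG := fg_adjoin_subalgebra_union B hBfg uu
  have hBA₂ : B ≤ A₂ := fun x hx => Algebra.subset_adjoin (Or.inl hx)
  have huuA₂ : ∀ w ∈ (uu : Set K), w ∈ A₂ := fun w hw => Algebra.subset_adjoin (Or.inr hw)
  have hA₂Ok : A₂ ≤ Ok := Algebra.adjoin_le (Set.union_subset hBO huuO')
  have hA₂O : A₂.toSubring ≤ O.toSubring := fun x hx => hA₂Ok hx
  -- values in `O ∩ k₀(S)` are read in `K`
  have hval1 : ∀ y : IntermediateField.adjoin k₀ S, y ∈ O.comap (algebraMap (IntermediateField.adjoin k₀ S) K) →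
      ((O.comap (algebraMap (IntermediateField.adjoin k₀ S) K)).valuation y = 1 ↔
        O.valuation (algebraMap (IntermediateField.adjoin k₀ S) K y) = 1) := by
    intro y hy
    have hyO : algebraMap (IntermediateField.adjoin k₀ S) K y ∈ O := ValuationSubring.mem_comap.mp hy
    have hlt := TwistModel.valuation_comap_lt_one_iff O (IntermediateField.adjoin k₀ S) y hy
    have hle' : (O.comap (algebraMap (IntermediateField.adjoin k₀ S) K)).valuation y ≤ 1 :=
      ((O.comap (algebraMap (IntermediateField.adjoin k₀ S) K)).valuation_le_one_iff y).mpr hy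
    have hle : O.valuation (algebraMap (IntermediateField.adjoin k₀ S) K y) ≤ 1 := (O.valuation_le_one_iff _).mpr hyO
    constructor
    · intro h1
      rcases hle.lt_or_eq with h | h
      · have h' := hlt.mpr h
        rw [h1] at h'
        exact absurd h' (lt_irrefl _)
      · exact h
    · intro h1
      rcases hle'.lt_or_eq with h | h
      · have h' := hlt.mp h
        rw [h1] at h'
        exact absurd h' (lt_irrefl _)
      · exact h
  have hrangeR : Set.range (algebraMap R K) = (locAtCentre B.toSubring O : Set K) := by
    ext x
    constructor
    · rintro ⟨r, rfl⟩
      obtain ⟨y, hy, w, hw, hw1, hr⟩ := (mem_locAtCentre_iff).mp r.2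
      have hyB : (y : K) ∈ B := Subalgebra.mem_map.mpr ⟨y, hy, rfl⟩
      have hwB : (w : K) ∈ B := Subalgebra.mem_map.mpr ⟨w, hw, rfl⟩
      have hw1' : O.valuation (w : K) = 1 := (hval1 w (hA'O' hw)).mp hw1
      refine (mem_locAtCentre_iff).mpr ⟨y, hyB, w, hwB, hw1', ?_⟩
      rw [halgR, hr]
      push_cast
      rfl
    · intro hx
      obtain ⟨y, hy, w, hw, hw1, rfl⟩ := (mem_locAtCentre_iff).mp hx
      obtain ⟨y', hy', rfl⟩ := Subalgebra.mem_map.mp hy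
      obtain ⟨w', hw', rfl⟩ := Subalgebra.mem_map.mp hw
      have hw'1 : (O.comap (algebraMap (IntermediateField.adjoin k₀ S) K)).valuation w' = 1 := (hval1 w' (hA'O' hw')).mpr hw1
      refine ⟨⟨y' / w', (mem_locAtCentre_iff).mpr ⟨y', hy', w', hw', hw'1, rfl⟩⟩, ?_⟩
      rw [halgR]
      push_cast
      rfl
  have hT : T = Subring.closure ((locAtCentre B.toSubring O : Set K) ∪ ↑uu) := by
    change (Algebra.adjoin R (uu : Set K)).toSubring = _
    rw [Algebra.adjoin_eq_ring_closure, hrangeR]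
  have hR₂eq : locAtCentre T O = locAtCentre A₂.toSubring O := by
    rw [hT, Summit.ResolutionOfSingularities.ResolutionOfSingularities.Theorems.PfaffLine.locAtCentre_closure_locAtCentre_union,
      Subalgebra.coe_toSubring, closure_subalgebra_union_eq]
  -- regular data transported to `R₂ := locAtCentre A₂ O` along `R' ≅ range = R₂`
  set R₂ : Subring K := locAtCentre A₂.toSubring O with hR₂def
  have hrange0 : (algebraMap R' K).range = locAtCentre T O :=
    Summit.ResolutionOfSingularities.ResolutionOfSingularities.Theorems.RadicialJung.CleanModels.range_eq_locAtCentre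
      (algebraMap R' K) O T hTR hR'm hup
  have hrange : (algebraMap R' K).range = R₂ := hrange0.trans hR₂eq
  obtain ⟨hreg₂, z₂, u₂, hz₂, hu₂K, hspan₂, hdim₂, hu₂⟩ :=
    Summit.ResolutionOfSingularities.ResolutionOfSingularities.Theorems.RadicialJung.CleanModels.regular_data_of_range_eq
      (algebraMap R' K) hinj R₂ hrange z hspan hdimR' u hu
  haveI := hreg₂
  have hR₂O : R₂ ≤ O.toSubring := locAtCentre_le hA₂O
  have hTR₂ : T ≤ R₂ := le_of_le_of_eq (le_locAtCentre T O) hR₂eq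
  -- ## `S ⊆ B`, hence `t^p ⊆ A₂` and `A^p ⊆ A₂`
  have hSB : ∀ s ∈ S, s ∈ B := by
    intro s hs
    have hsM' : s ∈ IntermediateField.adjoin k₀ S := IntermediateField.subset_adjoin k₀ S hs
    have h1 : (⟨s, hsM'⟩ : IntermediateField.adjoin k₀ S) ∈ A' :=
      hSA' (Algebra.subset_adjoin
        (show (⟨s, hsM'⟩ : IntermediateField.adjoin k₀ S) ∈ (Subtype.val : IntermediateField.adjoin k₀ S → K) ⁻¹' S from hs))
    exact Subalgebra.mem_map.mpr ⟨⟨s, hsM'⟩, h1, rfl⟩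
  have hAp : ∀ a ∈ A, a ^ p ∈ A₂ := by
    intro a ha
    have ha' : a ∈ Algebra.adjoin k (t : Set K) := by rw [ht]; exact ha
    have h1 := pow_mem_adjoin_image_pow₂ p hFrob (t : Set K) ha'
    refine (Algebra.adjoin_le ?_ : Algebra.adjoin k₀ ((fun x : K => x ^ p) '' (t : Set K)) ≤ A₂) h1
    intro s hs
    exact hBA₂ (hSB s (by rw [hSdef]; exact Or.inl hs))
  -- ## `d = 3`: `centre_closed_and_dim_three_of_pow_mem₂`
  have htpA₂ : ∀ a ∈ (t : Set K), a ^ p ∈ A₂ := fun a ha => hAp a (by rw [← ht]; exact Algebra.subset_adjoin ha)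
  obtain ⟨-, -, hdimR₂'⟩ :=
    centre_closed_and_dim_three_of_pow_mem₂ hp.pos hFrob O A hAO hAfg hdimAeq t ht hzd A₂ hA₂O hA₂fg htpA₂
  have hdimR₂ : ringKrullDim R₂ = 3 := hdimR₂'
  have hd3 : d = 3 := by
    have h := hdim₂.symm.trans hdimR₂
    exact_mod_cast h
  subst hd3
  -- ## `z₂` is a regular system of parameters; `xR = u₂ ∏ z₂^α` in `R₂`
  have hd' : (maximalIdeal R₂).spanFinrank = 3 := by
    have h := IsRegularLocalRing.spanFinrank_maximalIdeal (R := R₂)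
    rw [hdim₂] at h
    exact_mod_cast h
  have hzr : IsRsopPart z₂ := isRsopPart_comp_of_rsop hd' z₂ hspan₂ id Function.injective_id
  have hz0 : ∀ i, (z₂ i : K) ≠ 0 := fun i h => hzr.ne_zero i (Subtype.ext h)
  let ψ : R →+* R₂ := (algebraMap R K).codRestrict R₂ (fun r => hTR₂ (hRT r))
  have hψK : ∀ r : R, ((ψ r : R₂) : K) = algebraMap R K r := fun _ => rfl
  have hfact₂ : ψ xR = u₂ * ∏ i, z₂ i ^ α i := by
    apply Subtype.ext
    rw [hψK, hfact]
    push_cast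
    simp only [hu₂K, hz₂]
  -- ## `locAtCentre A₂ O ⊆ M`
  let MR : Subalgebra R K :=
    { (IntermediateField.adjoin k₀ S).toSubalgebra.toSubring with
      algebraMap_mem' := fun r : R => ((r : IntermediateField.adjoin k₀ S)).2 }
  have huuMR : (uu : Set K) ⊆ (MR : Set K) := by
    intro w hw
    obtain ⟨y, rfl⟩ := huuM' hw
    exact y.2
  have hTM' : ∀ x ∈ T, x ∈ IntermediateField.adjoin k₀ S := fun x hx =>
    (Algebra.adjoin_le huuMR : Algebra.adjoin R (uu : Set K) ≤ MR) hx
  have hR₂M : ∀ r : K, r ∈ locAtCentre A₂.toSubring O → r ∈ M := by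
    intro r hr
    have hr' : r ∈ locAtCentre T O := (le_of_eq hR₂eq.symm) hr
    obtain ⟨y, hy, w, hw, -, rfl⟩ := mem_locAtCentre_iff.mp hr'
    exact (hM'M _).mp (div_mem (hTM' y hy) (hTM' w hw))
  -- ## assemble
  refine ⟨A₂, hA₂O, hA₂fg, hAp, hR₂M, hreg₂, z₂, hspan₂, hdimR₂, hz0, ?_⟩
  intro f hf
  have hsplit_c : xR = rc f * (g * rd f * ∏ f' ∈ F.erase f, (rc f' * rd f')) := by
    rw [hxRdef, ← Finset.mul_prod_erase F (fun f' => rc f' * rd f') hf]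
    ring
  have hsplit_d : xR = rd f * (g * rc f * ∏ f' ∈ F.erase f, (rc f' * rd f')) := by
    rw [hxRdef, ← Finset.mul_prod_erase F (fun f' => rc f' * rd f') hf]
    ring
  have hdvd_c : ψ (rc f) ∣ ∏ i, z₂ i ^ α i :=
    (hu₂.dvd_mul_left).mp ⟨ψ (g * rd f * ∏ f' ∈ F.erase f, (rc f' * rd f')), by rw [← map_mul, ← hsplit_c, hfact₂]⟩
  have hdvd_d : ψ (rd f) ∣ ∏ i, z₂ i ^ α i :=
    (hu₂.dvd_mul_left).mp ⟨ψ (g * rc f * ∏ f' ∈ F.erase f, (rc f' * rd f')), by rw [← map_mul, ← hsplit_d, hfact₂]⟩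
  obtain ⟨c₁, β, hcβ⟩ := CossartPiltantMonomial.exists_eq_units_mul_prod_pow_of_dvd (fun i => hzr.prime i) α hdvd_c
  obtain ⟨c₂, γ, hdγ⟩ := CossartPiltantMonomial.exists_eq_units_mul_prod_pow_of_dvd (fun i => hzr.prime i) α hdvd_d
  have hcK : cF f = ((c₁ : R₂) : K) * ∏ i, (z₂ i : K) ^ β i := by
    have h := congrArg (fun w : R₂ => (w : K)) hcβ
    simp only [hψK, hrc f hf] at h
    rw [h]
    push_cast
    rfl
  have hdK : dF f = ((c₂ : R₂) : K) * ∏ i, (z₂ i : K) ^ γ i := by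
    have h := congrArg (fun w : R₂ => (w : K)) hdγ
    simp only [hψK, hrd f hf] at h
    rw [h]
    push_cast
    rfl
  let u' : R₂ := (c₁ * c₂⁻¹ : R₂ˣ)
  have hu' : IsUnit u' := Units.isUnit _
  let e : Fin 3 → ℤ := fun i => (β i : ℤ) - (γ i : ℤ)
  have hc₂0 : ((c₂ : R₂) : K) ≠ 0 := fun h => by
    have : ((c₂ : R₂) : K) * ((↑(c₂⁻¹ : R₂ˣ) : R₂) : K) = 1 := by
      rw [← Subring.coe_mul, ← Units.val_mul, mul_inv_cancel, Units.val_one, Subring.coe_one]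
    rw [h, zero_mul] at this
    exact zero_ne_one this
  have hu'K : (u' : K) = ((c₁ : R₂) : K) * (((c₂ : R₂) : K))⁻¹ := by
    have hinv : ((↑(c₂⁻¹ : R₂ˣ) : R₂) : K) = (((c₂ : R₂) : K))⁻¹ := by
      refine (eq_inv_of_mul_eq_one_right ?_)
      rw [← Subring.coe_mul, ← Units.val_mul, mul_inv_cancel, Units.val_one, Subring.coe_one]
    change (((c₁ * c₂⁻¹ : R₂ˣ) : R₂) : K) = _
    rw [Units.val_mul, Subring.coe_mul, hinv]
  have hprod : (∏ i, (z₂ i : K) ^ (e i)) = (∏ i, (z₂ i : K) ^ β i) / ∏ i, (z₂ i : K) ^ γ i := by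
    rw [← Finset.prod_div_distrib]
    refine Finset.prod_congr rfl fun i _ => ?_
    rw [zpow_sub₀ (hz0 i), zpow_natCast, zpow_natCast]
  refine ⟨(u' : K), e, u'.2, valuation_eq_one_of_isUnit_of_le O hR₂O hu', ?_⟩
  calc f = cF f / dF f := hFeq f hf
    _ = (u' : K) * ∏ i, (z₂ i : K) ^ (e i) := by
        rw [hcK, hdK, hu'K, hprod, mul_div_mul_comm, div_eq_mul_inv]

end TwoField

end Summit.ResolutionOfSingularities.ResolutionOfSingularities.Theorems.RadicialJungCleanModels.Lens5TFrame

end
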